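import Summits.ValiantsHypothesis.ValiantsHypothesis.Theorems.SymPencilPerFourW2Forms
import Summits.ValiantsHypothesis.ValiantsHypothesis.Theorems.SymPencilAffineKernelLeverInvariance

/-!
# Route `SymPencil` — the space `W₂ = row 0 ⊕ span(E₁₀, E₁₁)` at size `27`, IV: the lever core
# (`--supports` stmt-ValiantsHypothesis-5674 `SdcSuperquadratic`; cell `(10,6,6)`; rung currency
# only, nothing here bears on `VP ≠ VNP`)

`w2_lever_core`: the affine lever of `SymPencilAffineKernelLeverInvariance` for a one-row kernel
direction `d` of `W₂`, in complement coordinates `u = (r, c)` (`bU u = bL (embU u)`): `K_d =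
im bL ∩ N_d⁻¹ im bL` has dimension `≥ 7`; for `t ≠ 0` the pulled-back lever space
`S_t = bU⁻¹ (T_t K_d)` has dimension `≥ 7` and each of its points satisfies the base-point
condition `(D + CL (t d))⁻¹ bL (embU u) ∈ D⁻¹ im bL`; and a CLASSIFIER — a dichotomy
`P₁ | P₂` of linear predicates valid on every such `S_t` — transfers to `K_d` itself by the
pigeonhole `t ∈ {1,2,3}`: `K_d ⊆ bU {P₁}` or `K_d ⊆ bU {P₂}`.  The instances (`a = E₀₁+E₀₂+E₀₃`
with `X^±`, `b = E₁₀` with `Y^±`) follow in part V.  `Cruxes/SdcSuperquadratic/PENCIL-CROSS-27.md`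
rev 6 §W₂.  No definitions, no named facts. [folklore]
-/

noncomputable section

-- single-conjunct layout: Sub = Summit, duplicated namespace component intended
set_option linter.dupNamespace false

namespace Summit.ValiantsHypothesis.ValiantsHypothesis.Theorems.SymPencilPerFourW2Lever

open Matrix MvPolynomial Module
open Literature.Computability.AlgebraicComplexity
open Summit.ValiantsHypothesis.ValiantsHypothesis.Theorems.SymPencilAffineKernelLever
open Summit.ValiantsHypothesis.ValiantsHypothesis.Theorems.SymPencilAffineKernelLeverInvariance
open Summit.ValiantsHypothesis.ValiantsHypothesis.Theorems.SymPencilSdcPerFourTwentySeven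

universe u

variable {k : Type u} [Field k] [CharZero k] {ι' : Type*} [Fintype ι'] [DecidableEq ι']

/-- **The `W₂` lever core with a classifier** (see the module docstring). [folklore] -/
theorem w2_lever_core {D : Matrix ι' ι' k} (hD : IsUnit D.det) (hDs : Dᵀ = D)
    (bL : (Fin 4 × Fin 4 → k) →ₗ[k] (ι' → k)) (CL : (Fin 4 × Fin 4 → k) →ₗ[k] Matrix ι' ι' k)
    (hCs : ∀ z, (CL z)ᵀ = CL z) {κ : k} (hκ : κ ≠ 0)
    (hN : ∀ v, bL v = 0 → IsUnit (D + CL v).det ∧ ∀ (z : Fin 4 × Fin 4 → k) (s : k),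
      κ * MvPolynomial.eval (v + s • z) (perPoly (Fin 4) k) =
        (Matrix.fromBlocks ((s * 0) • (1 : Matrix Unit Unit k))
          (Matrix.replicateRow Unit (s • bL z)) (Matrix.replicateCol Unit (s • bL z))
          (D + CL v + s • CL z)).det)
    (hker : ∀ x : Fin 4 × Fin 4 → k,
      bL x = 0 ↔ ∀ z : Fin 4 × Fin 4, ¬ (z.1 = 0 ∨ z = (1, 0) ∨ z = (1, 1)) → x z = 0)
    (h10 : 10 ≤ finrank k (LinearMap.range bL)) (hcard : Fintype.card ι' ≤ 26)
    (d : Fin 4 × Fin 4 → k) (l : Fin 4) (hrow : ∀ (t : k) (i j : Fin 4), i ≠ l → (t • d) (i, j) = 0)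
    (hd_ker : ∀ t : k, bL (t • d) = 0)
    (P₁ P₂ : ((Fin 2 × Fin 3 → k) × (Fin 4 → k)) → Prop)
    (hP₁ : ∀ (c₁ c₂ : k) (u w : (Fin 2 × Fin 3 → k) × (Fin 4 → k)), P₁ u → P₁ w →
      P₁ (c₁ • u + c₂ • w))
    (hP₂ : ∀ (c₁ c₂ : k) (u w : (Fin 2 × Fin 3 → k) × (Fin 4 → k)), P₂ u → P₂ w →
      P₂ (c₁ • u + c₂ • w))
    (hclass : ∀ t : k, t ≠ 0 → ∀ S : Submodule k ((Fin 2 × Fin 3 → k) × (Fin 4 → k)),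
      7 ≤ finrank k S →
      (∀ u ∈ S, ∃ z₀ : Fin 4 × Fin 4 → k,
        (D + CL (t • d))⁻¹ *ᵥ bL (fun z : Fin 4 × Fin 4 => (Matrix.of ![![0, 0, 0, 0], ![0, 0, u.2 0, u.2 1],
        ![u.2 2, u.1 (0, 0), u.1 (0, 1), u.1 (0, 2)], ![u.2 3, u.1 (1, 0), u.1 (1, 1), u.1 (1, 2)]])
        z.1 z.2) = D⁻¹ *ᵥ bL z₀) →
      (∀ u ∈ S, P₁ u) ∨ (∀ u ∈ S, P₂ u)) :
    7 ≤ finrank k (LinearMap.range bL ⊓ (LinearMap.range bL).comap (CL d * D⁻¹).mulVecLin :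
        Submodule k (ι' → k)) ∧
    ((∀ y ∈ (LinearMap.range bL ⊓ (LinearMap.range bL).comap (CL d * D⁻¹).mulVecLin :
        Submodule k (ι' → k)), ∃ u, P₁ u ∧ y = bL (fun z : Fin 4 × Fin 4 => (Matrix.of ![![0, 0, 0, 0], ![0, 0, u.2 0, u.2 1],
        ![u.2 2, u.1 (0, 0), u.1 (0, 1), u.1 (0, 2)], ![u.2 3, u.1 (1, 0), u.1 (1, 1), u.1 (1, 2)]])
        z.1 z.2)) ∨
     (∀ y ∈ (LinearMap.range bL ⊓ (LinearMap.range bL).comap (CL d * D⁻¹).mulVecLin :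
        Submodule k (ι' → k)), ∃ u, P₂ u ∧ y = bL (fun z : Fin 4 × Fin 4 => (Matrix.of ![![0, 0, 0, 0], ![0, 0, u.2 0, u.2 1],
        ![u.2 2, u.1 (0, 0), u.1 (0, 1), u.1 (0, 2)], ![u.2 3, u.1 (1, 0), u.1 (1, 1), u.1 (1, 2)]])
        z.1 z.2))) := by
  classical
  have haff : ∀ (t : k) (z : Fin 4 × Fin 4 → k), ∃ e₀ e₁ : k, ∀ s : k,
      MvPolynomial.eval (z + s • (t • d)) (perPoly (Fin 4) k) = e₀ + s * e₁ := fun t z =>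
    affine_of_row k l (t • d) (hrow t) z
  set B := LinearMap.range bL with hBdef
  set N := (CL d * D⁻¹).mulVecLin with hNdef
  set K := (B ⊓ B.comap N : Submodule k (ι' → k)) with hKdef
  -- dimension
  have hK7 : 7 ≤ finrank k K := by
    have h := four_mul_finrank_le_finrank_K hD hDs bL CL hCs hκ hN d
      (by simpa using hd_ker 1) (fun z => by simpa using haff 1 z)
    rw [← hBdef, ← hNdef, ← hKdef] at h
    omega
  refine ⟨hK7, ?_⟩
  -- the embedding of the complement coordinates
  let embU : ((Fin 2 × Fin 3 → k) × (Fin 4 → k)) →ₗ[k] (Fin 4 × Fin 4 → k) :=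
    { toFun := fun u => (fun z : Fin 4 × Fin 4 => (Matrix.of ![![0, 0, 0, 0], ![0, 0, u.2 0, u.2 1],
        ![u.2 2, u.1 (0, 0), u.1 (0, 1), u.1 (0, 2)], ![u.2 3, u.1 (1, 0), u.1 (1, 1), u.1 (1, 2)]])
        z.1 z.2)
      map_add' := fun x y => by
        funext z; obtain ⟨i, j⟩ := z
        fin_cases i <;> fin_cases j <;> simp
      map_smul' := fun c x => by
        funext z; obtain ⟨i, j⟩ := z
        fin_cases i <;> fin_cases j <;> simp }
  have hembU : ∀ u, embU u = (fun z : Fin 4 × Fin 4 => (Matrix.of ![![0, 0, 0, 0], ![0, 0, u.2 0, u.2 1],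
        ![u.2 2, u.1 (0, 0), u.1 (0, 1), u.1 (0, 2)], ![u.2 3, u.1 (1, 0), u.1 (1, 1), u.1 (1, 2)]])
        z.1 z.2) := fun _ => rfl
  set bU := bL ∘ₗ embU with hbU
  have hbU' : ∀ u, bU u = bL (fun z : Fin 4 × Fin 4 => (Matrix.of ![![0, 0, 0, 0], ![0, 0, u.2 0, u.2 1],
        ![u.2 2, u.1 (0, 0), u.1 (0, 1), u.1 (0, 2)], ![u.2 3, u.1 (1, 0), u.1 (1, 1), u.1 (1, 2)]])
        z.1 z.2) := fun _ => rfl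
  have hbUe : ∀ u, bU u = bL (embU u) := fun _ => rfl
  -- every row is a `bU`-image
  have hBU : ∀ x, ∃ u, bL x = bU u := by
    intro x
    refine ⟨(fun p : Fin 2 × Fin 3 => x ((![2, 3] : Fin 2 → Fin 4) p.1, p.2.succ),
      ![x (1, 2), x (1, 3), x (2, 0), x (3, 0)]), ?_⟩
    rw [hbUe, ← sub_eq_zero, ← map_sub, hker]
    intro z hz
    obtain ⟨i, j⟩ := z
    rw [Pi.sub_apply, hembU]
    clear_value embU bU
    fin_cases i
    · exact absurd (Or.inl rfl) hz
    all_goals fin_cases j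
    all_goals first
      | exact absurd (Or.inr (Or.inl rfl)) hz
      | exact absurd (Or.inr (Or.inr rfl)) hz
      | simp
  clear_value embU bU
  have hBle : B ≤ LinearMap.range bU := by
    rintro _ ⟨x, rfl⟩
    obtain ⟨u, hu⟩ := hBU x
    exact ⟨u, hu.symm⟩
  -- the lever spaces `S_t`
  have hTt : ∀ t : k, IsUnit (D + t • CL d).det := fun t => by
    rw [← map_smul]; exact (hN _ (hd_ker t)).1
  have hS : ∀ t : k, t ≠ 0 →
      7 ≤ finrank k ((K.map ((D + t • CL d) * D⁻¹).mulVecLin).comap bU) ∧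
      (∀ u ∈ (K.map ((D + t • CL d) * D⁻¹).mulVecLin).comap bU, ∃ z₀ : Fin 4 × Fin 4 → k,
        (D + CL (t • d))⁻¹ *ᵥ bL (fun z : Fin 4 × Fin 4 => (Matrix.of ![![0, 0, 0, 0], ![0, 0, u.2 0, u.2 1],
        ![u.2 2, u.1 (0, 0), u.1 (0, 1), u.1 (0, 2)], ![u.2 3, u.1 (1, 0), u.1 (1, 1), u.1 (1, 2)]])
        z.1 z.2) = D⁻¹ *ᵥ bL z₀) ∧
      (∀ y ∈ K, ∃ u ∈ (K.map ((D + t • CL d) * D⁻¹).mulVecLin).comap bU,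
        y + t • N y = bU u) := by
    intro t ht
    set Tt := ((D + t • CL d) * D⁻¹).mulVecLin with hTtdef
    set Mt := K.map Tt with hMt
    have hMeq : (B ⊓ B.map Tt : Submodule k (ι' → k)) = Mt := by
      rw [hMt, hKdef, hNdef, hTtdef]; exact lever_space_eq_map hD (CL d) B t ht
    have hMtB : Mt ≤ B := by rw [← hMeq]; exact inf_le_left
    have hMtU : Mt ≤ LinearMap.range bU := hMtB.trans hBle
    refine ⟨?_, ?_, ?_⟩
    · have h1 : finrank k Mt = finrank k K :=
        (Submodule.equivMapOfInjective _ (translate_injective hD (CL d) t (hTt t)) K).finrank_eq.symm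
      have h2 : (Mt.comap bU).map bU = Mt := Submodule.map_comap_eq_self hMtU
      have h3 := Submodule.finrank_map_le bU (Mt.comap bU)
      rw [h2] at h3
      omega
    · intro u hu
      rw [Submodule.mem_comap] at hu
      have hu' : bU u ∈ (B ⊓ B.map Tt : Submodule k (ι' → k)) := by rw [hMeq]; exact hu
      obtain ⟨-, hu''⟩ := Submodule.mem_inf.1 hu'
      obtain ⟨_, ⟨z₀, rfl⟩, hyz⟩ := Submodule.mem_map.1 hu''
      refine ⟨z₀, ?_⟩
      rw [← hbU', ← hyz, hTtdef, Matrix.mulVecLin_apply, Matrix.mulVec_mulVec, ← Matrix.mul_assoc,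
        map_smul, Matrix.nonsing_inv_mul _ (hTt t), Matrix.one_mul]
    · intro y hy
      have hTy : Tt y ∈ Mt := ⟨y, hy, rfl⟩
      obtain ⟨u, hu⟩ := hMtU hTy
      refine ⟨u, ?_, ?_⟩
      · rw [Submodule.mem_comap, hu]; exact hTy
      · rw [hu, hTtdef, translate_apply hD]
  -- transfer along two values of `t`
  have transfer : ∀ (P : ((Fin 2 × Fin 3 → k) × (Fin 4 → k)) → Prop),
      (∀ (c₁ c₂ : k) u w, P u → P w → P (c₁ • u + c₂ • w)) →
      ∀ t₁ t₂ : k, t₁ ≠ 0 → t₂ ≠ 0 → t₁ ≠ t₂ →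
      (∀ u ∈ (K.map ((D + t₁ • CL d) * D⁻¹).mulVecLin).comap bU, P u) →
      (∀ u ∈ (K.map ((D + t₂ • CL d) * D⁻¹).mulVecLin).comap bU, P u) →
      ∀ y ∈ K, ∃ u, P u ∧ y = bL (fun z : Fin 4 × Fin 4 => (Matrix.of ![![0, 0, 0, 0], ![0, 0, u.2 0, u.2 1],
        ![u.2 2, u.1 (0, 0), u.1 (0, 1), u.1 (0, 2)], ![u.2 3, u.1 (1, 0), u.1 (1, 1), u.1 (1, 2)]])
        z.1 z.2) := by
    intro P hP t₁ t₂ ht₁ ht₂ h12 hS₁ hS₂ y hy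
    obtain ⟨u₁, hu₁, e₁⟩ := (hS t₁ ht₁).2.2 y hy
    obtain ⟨u₂, hu₂, e₂⟩ := (hS t₂ ht₂).2.2 y hy
    have hne : t₂ - t₁ ≠ 0 := sub_ne_zero.2 (Ne.symm h12)
    refine ⟨((t₂ - t₁)⁻¹ * t₂) • u₁ + (-((t₂ - t₁)⁻¹ * t₁)) • u₂,
      hP _ _ _ _ (hS₁ u₁ hu₁) (hS₂ u₂ hu₂), ?_⟩
    rw [← hbU']
    have h : (t₂ - t₁) • y = bU (t₂ • u₁ - t₁ • u₂) := by
      rw [map_sub, map_smul, map_smul, ← e₁, ← e₂]; module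
    have h2 : ((t₂ - t₁)⁻¹ * t₂) • u₁ + (-((t₂ - t₁)⁻¹ * t₁)) • u₂ =
        (t₂ - t₁)⁻¹ • (t₂ • u₁ - t₁ • u₂) := by module
    rw [h2, map_smul, ← h, smul_smul, inv_mul_cancel₀ hne, one_smul]
  -- pigeonhole on `t ∈ {1,2,3}`
  have c1 := hclass 1 one_ne_zero _ (hS 1 one_ne_zero).1 (hS 1 one_ne_zero).2.1
  have c2 := hclass 2 two_ne_zero _ (hS 2 two_ne_zero).1 (hS 2 two_ne_zero).2.1
  have c3 := hclass 3 three_ne_zero _ (hS 3 three_ne_zero).1 (hS 3 three_ne_zero).2.1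
  rcases c1 with c1 | c1 <;> rcases c2 with c2 | c2
  · exact Or.inl (transfer P₁ hP₁ 1 2 one_ne_zero two_ne_zero (by norm_num) c1 c2)
  · rcases c3 with c3 | c3
    · exact Or.inl (transfer P₁ hP₁ 1 3 one_ne_zero three_ne_zero (by norm_num) c1 c3)
    · exact Or.inr (transfer P₂ hP₂ 2 3 two_ne_zero three_ne_zero (by norm_num) c2 c3)
  · rcases c3 with c3 | c3
    · exact Or.inl (transfer P₁ hP₁ 2 3 two_ne_zero three_ne_zero (by norm_num) c2 c3)
    · exact Or.inr (transfer P₂ hP₂ 1 3 one_ne_zero three_ne_zero (by norm_num) c1 c3)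
  · exact Or.inr (transfer P₂ hP₂ 1 2 one_ne_zero two_ne_zero (by norm_num) c1 c2)

end Summit.ValiantsHypothesis.ValiantsHypothesis.Theorems.SymPencilPerFourW2Lever

end
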